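import Summits.AtomisticToContinuum.HydrodynamicLimit.Theorems.JParityClosureParityBandClosurePressureValuePathwise
import HarnessLib

/-!
# `EvenStressEnskog` + weak stress isotropy ⇒ the collisional pressure value — part C: the deterministic terms

Helper for the line `Sketch` of the crux `JParityClosure.ParityBandClosure` (stmt-AtomisticToContinuum-17608), stub
`stub_pressureValueOfEvenStress`.  Along ONE good orbit the Enskog predictions of `EvenStressEnskog` with weights
`χ = a_{kl}`, summed over `(k, l)`, equal EXACTLY `2 ×` the pressure term of `CollisionalPressureValueInBand` plus
`8π/15 ×` the weak-isotropy functional of `WeakStressIsotropyInBand` for the traceless part of `a` and the cut-off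
`b ↦ b⁺ g(b) Ỹ(b)` (`sum_enskog_integral_eq`): the pointwise identity of part A integrated over `[0, t] × 𝕋³`, every
exchange of a finite sum with a Bochner integral being honest (`integrableOn_enskogRate_flow`,
`integrable_enskogIntegrand`, `integrable_continuous_flow`).

References: S. Chapman, T. G. Cowling (1970) §16.4; H. van Beijeren, M. H. Ernst, Physica 68 (1973) 437.
-/

noncomputable section

namespace Summit.AtomisticToContinuum.HydrodynamicLimit.Theorems.ParityBandClosurePressureValue

open scoped BigOperators InnerProductSpace ENNReal Topology
open MeasureTheory Set Filter
open Literature.MathematicalPhysics.KineticTheory Literature.Analysis.FluidPDE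

variable {N : ℕ}

/-! ## Bounds for the honest exchanges -/

/-- **`g · Y` is bounded on `[0, ∞)`** when `Y` agrees on `(0, η₁)` with a continuous `Ỹ` and the continuous cut-off `g`
vanishes on `[η₀', ∞)`, `0 < η₀' ≤ η₁` (at `b = 0` the junk value `Y(0)` is one more constant). [folklore] -/
theorem exists_bound_cutoff_mul_contactValue {Yt g : ℝ → ℝ} {η₀' η₁ : ℝ}
    (hY : ∀ b ∈ Ioo 0 η₁, Yt b = contactValue b) (hg0 : ∀ b, η₀' ≤ b → g b = 0) (hle : η₀' ≤ η₁) (hη : 0 < η₀')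
    (hg : Continuous g) (hYt : Continuous Yt) : ∃ C, ∀ b, 0 ≤ b → |g b * contactValue b| ≤ C := by
  obtain ⟨M, hM⟩ := (isCompact_Icc : IsCompact (Icc 0 η₀')).exists_bound_of_continuousOn
    ((hg.mul hYt).continuousOn (s := Icc 0 η₀'))
  have hM0 : 0 ≤ M := (norm_nonneg _).trans (hM 0 ⟨le_rfl, hη.le⟩)
  refine ⟨max M |g 0 * contactValue 0|, fun b hb => ?_⟩
  rcases hb.eq_or_lt with h | h
  · rw [← h]
    exact le_max_right _ _
  · by_cases hlt : b < η₀'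
    · rw [← hY b ⟨h, hlt.trans_le hle⟩]
      have := hM b ⟨hb, hlt.le⟩
      rw [Real.norm_eq_abs] at this
      exact this.trans (le_max_left _ _)
    · rw [hg0 b (not_lt.1 hlt), zero_mul, abs_zero]
      exact hM0.trans (le_max_left _ _)

/-- A continuous function on `ℝ × 𝕋³` is bounded on every strip `[0, t] × 𝕋³`. [folklore] -/
theorem exists_bound_strip {f : ℝ × T3 → ℝ} (hf : Continuous f) (t : ℝ) :
    ∃ C, ∀ s ∈ Icc (0 : ℝ) t, ∀ x : T3, |f (s, x)| ≤ C := by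
  obtain ⟨C, hC⟩ := (isCompact_Icc.prod isCompact_univ :
    IsCompact (Icc (0 : ℝ) t ×ˢ (univ : Set T3))).exists_bound_of_continuousOn hf.continuousOn
  exact ⟨C, fun s hs x => by simpa only [Real.norm_eq_abs] using hC (s, x) ⟨hs, mem_univ x⟩⟩

/-! ## The deterministic identity along a good orbit -/

/-- **The summed Enskog predictions, exactly.**  Along a good orbit, for continuous `a, g, Ỹ` with `Ỹ = Y` on
`(0, η₁)`, `g = 0` on `[η₀', ∞)`, `0 < η₀' ≤ η₁`:
`Σ_{kl} σ³ ∫₀ᵗ e_s(a_{kl}, Ξ_P^{kl})(Φ_s z) ds = 2 ∫₀ᵗ∫ g (p_hs − ρ_rθ_r) tr a + (8π/15) ∫₀ᵗ∫ (σ³ρ_r)⁺ g Ỹ (a⁰ : P)` —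
the right-hand side being verbatim (vocabulary `mollDensity, mollMomentum, mollTemperature`) twice the pressure term of
`CollisionalPressureValueInBand` plus `8π/15` times the functional of `WeakStressIsotropyInBand` for the traceless
field `a⁰` and the cut-off `b ↦ b⁺ g(b) Ỹ(b)`. [folklore] -/
theorem sum_enskog_integral_eq {σ r t η₀' η₁ : ℝ} {Yt g : ℝ → ℝ} {a : Fin 3 → Fin 3 → ℝ × T3 → ℝ}
    (hY : ∀ b ∈ Ioo 0 η₁, Yt b = contactValue b) (hg0 : ∀ b, η₀' ≤ b → g b = 0) (hle : η₀' ≤ η₁) (hη : 0 < η₀')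
    (hσ : 0 < σ) (hr : 0 < r) (ha : ∀ j k, Continuous (a j k)) (hg : Continuous g) (hYt : Continuous Yt)
    (Φ : HardSphereFlow (Torus.geometry (Fin 3)) (hsDiameter σ N) (N + 1)) {z : Config (N + 1) (Fin 3) T3}
    (hz : z ∈ Φ.good) :
    ∑ k, ∑ l, σ ^ 3 * ∫ s in Icc 0 t, enskogRate σ N (a k l) g (evenMark k l) r s (Φ.flow s z) =
      2 * (∫ s in Icc 0 t, ∫ x, g (σ ^ 3 * mollDensity r (Φ.flow s z) x) * (hsPressure σ (mollDensity r (Φ.flow s z) x) (mollTemperature r (Φ.flow s z) x) - mollDensity r (Φ.flow s z) x * mollTemperature r (Φ.flow s z) x) * ∑ k, a k k (s, x)) +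
        8 * Real.pi / 15 * ∫ s in Icc 0 t, ∫ x,
          max (σ ^ 3 * mollDensity r (Φ.flow s z) x) 0 * g (σ ^ 3 * mollDensity r (Φ.flow s z) x) * Yt (σ ^ 3 * mollDensity r (Φ.flow s z) x) * ∑ j, ∑ k, (a j k (s, x) - if j = k then (∑ i, a i i (s, x)) / 3 else 0) * ((∫ q, coneKernel r q.1 x * (q.2 j * q.2 k) ∂(empiricalMeasure (Φ.flow s z))) - mollMomentum r (Φ.flow s z) x j * mollMomentum r (Φ.flow s z) x k / mollDensity r (Φ.flow s z) x) := by
  -- honest-exchange data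
  obtain ⟨CgY, hgY⟩ := exists_bound_cutoff_mul_contactValue hY hg0 hle hη hg hYt
  have hIe : ∀ k l, IntegrableOn (fun s => enskogRate σ N (a k l) g (evenMark k l) r s (Φ.flow s z)) (Icc 0 t) := by
    intro k l
    obtain ⟨C, hC⟩ := exists_bound_strip (ha k l) t
    exact integrableOn_enskogRate_flow Φ hz (ha k l) hg hC hgY hσ.le hr
      (continuous_sphereMark_uncurry (continuous_evenMark k l)).measurable (abs_sphereMark_evenMark_le' k l)
  have hIx : ∀ k l s, Integrable (fun x => a k l (s, x) * g (σ ^ 3 * mollDensity r (Φ.flow s z) x) *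
      contactValue (σ ^ 3 * mollDensity r (Φ.flow s z) x) * pairFunctional r (evenMark k l) (Φ.flow s z) x) :=
    fun k l s => integrable_enskogIntegrand (ha k l) hg hgY hσ.le hr
      (continuous_sphereMark_uncurry (continuous_evenMark k l)).measurable (abs_sphereMark_evenMark_le' k l) s _
  have hWP := integrable_continuous_flow Φ hz (continuous_wsiPoly (N := N) (σ := σ) (r := r) ha hg hYt) t
  simp_rw [wsiIntegrand_eq_wsiPoly hσ hr]
  -- Step A: the `(k, l)`-sums enter the time integral
  have hA : ∑ k, ∑ l, σ ^ 3 * ∫ s in Icc 0 t, enskogRate σ N (a k l) g (evenMark k l) r s (Φ.flow s z) =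
      ∫ s in Icc 0 t, ∑ k, ∑ l, σ ^ 3 * enskogRate σ N (a k l) g (evenMark k l) r s (Φ.flow s z) := by
    rw [integral_finsetSum _ fun k _ => integrable_finsetSum _ fun l _ => (hIe k l).const_mul (σ ^ 3)]
    refine Finset.sum_congr rfl fun k _ => ?_
    rw [integral_finsetSum _ fun l _ => (hIe k l).const_mul (σ ^ 3)]
    refine Finset.sum_congr rfl fun l _ => ?_
    exact (integral_const_mul _ _).symm
  -- Step B: the identity at every time
  have hB : ∀ s, ∑ k, ∑ l, σ ^ 3 * enskogRate σ N (a k l) g (evenMark k l) r s (Φ.flow s z) =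
      2 * (∫ x, g (σ ^ 3 * mollDensity r (Φ.flow s z) x) * (hsPressure σ (mollDensity r (Φ.flow s z) x) (mollTemperature r (Φ.flow s z) x) - mollDensity r (Φ.flow s z) x * mollTemperature r (Φ.flow s z) x) * ∑ k, a k k (s, x)) +
      8 * Real.pi / 15 * ∫ x, σ ^ 3 * (g (σ ^ 3 * mollDensity r (Φ.flow s z) x) * Yt (σ ^ 3 * mollDensity r (Φ.flow s z) x)) * ∑ j, ∑ k, (a j k (s, x) - if j = k then (∑ i, a i i (s, x)) / 3 else 0) * (mollDensity r (Φ.flow s z) x * (∫ q, coneKernel r q.1 x * (q.2 j * q.2 k) ∂(empiricalMeasure (Φ.flow s z))) - mollMomentum r (Φ.flow s z) x j * mollMomentum r (Φ.flow s z) x k) := by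
    intro s
    have e1 : ∑ k, ∑ l, σ ^ 3 * enskogRate σ N (a k l) g (evenMark k l) r s (Φ.flow s z) =
        ∫ x, ∑ k, ∑ l, σ ^ 3 * (a k l (s, x) * g (σ ^ 3 * mollDensity r (Φ.flow s z) x) *
          contactValue (σ ^ 3 * mollDensity r (Φ.flow s z) x) * pairFunctional r (evenMark k l) (Φ.flow s z) x) := by
      unfold enskogRate
      rw [integral_finsetSum _ fun k _ => integrable_finsetSum _ fun l _ => (hIx k l s).const_mul (σ ^ 3)]
      refine Finset.sum_congr rfl fun k _ => ?_
      rw [integral_finsetSum _ fun l _ => (hIx k l s).const_mul (σ ^ 3)]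
      refine Finset.sum_congr rfl fun l _ => ?_
      exact (integral_const_mul _ _).symm
    have e2 : ∀ x, ∑ k, ∑ l, σ ^ 3 * (a k l (s, x) * g (σ ^ 3 * mollDensity r (Φ.flow s z) x) *
          contactValue (σ ^ 3 * mollDensity r (Φ.flow s z) x) * pairFunctional r (evenMark k l) (Φ.flow s z) x) =
        2 * (g (σ ^ 3 * mollDensity r (Φ.flow s z) x) * (hsPressure σ (mollDensity r (Φ.flow s z) x) (mollTemperature r (Φ.flow s z) x) - mollDensity r (Φ.flow s z) x * mollTemperature r (Φ.flow s z) x) * ∑ k, a k k (s, x)) +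
        8 * Real.pi / 15 * (σ ^ 3 * (g (σ ^ 3 * mollDensity r (Φ.flow s z) x) * Yt (σ ^ 3 * mollDensity r (Φ.flow s z) x)) * ∑ j, ∑ k, (a j k (s, x) - if j = k then (∑ i, a i i (s, x)) / 3 else 0) * (mollDensity r (Φ.flow s z) x * (∫ q, coneKernel r q.1 x * (q.2 j * q.2 k) ∂(empiricalMeasure (Φ.flow s z))) - mollMomentum r (Φ.flow s z) x j * mollMomentum r (Φ.flow s z) x k)) := by
      intro x
      rw [← wsiIntegrand_eq_wsiPoly hσ hr]
      exact stub_pressureValuePointwise hY hg0 hle hσ hr (fun k l => a k l (s, x)) (Φ.flow s z) x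
    have hsumI : Integrable (fun x => ∑ k, ∑ l, σ ^ 3 * (a k l (s, x) * g (σ ^ 3 * mollDensity r (Φ.flow s z) x) *
        contactValue (σ ^ 3 * mollDensity r (Φ.flow s z) x) * pairFunctional r (evenMark k l) (Φ.flow s z) x)) :=
      integrable_finsetSum _ fun k _ => integrable_finsetSum _ fun l _ => (hIx k l s).const_mul (σ ^ 3)
    have h2CW : Integrable (fun x => 2 * (g (σ ^ 3 * mollDensity r (Φ.flow s z) x) * (hsPressure σ (mollDensity r (Φ.flow s z) x) (mollTemperature r (Φ.flow s z) x) - mollDensity r (Φ.flow s z) x * mollTemperature r (Φ.flow s z) x) * ∑ k, a k k (s, x)) +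
        8 * Real.pi / 15 * (σ ^ 3 * (g (σ ^ 3 * mollDensity r (Φ.flow s z) x) * Yt (σ ^ 3 * mollDensity r (Φ.flow s z) x)) * ∑ j, ∑ k, (a j k (s, x) - if j = k then (∑ i, a i i (s, x)) / 3 else 0) * (mollDensity r (Φ.flow s z) x * (∫ q, coneKernel r q.1 x * (q.2 j * q.2 k) ∂(empiricalMeasure (Φ.flow s z))) - mollMomentum r (Φ.flow s z) x j * mollMomentum r (Φ.flow s z) x k))) :=
      hsumI.congr (ae_of_all _ e2)
    have hWx : Integrable (fun x => σ ^ 3 * (g (σ ^ 3 * mollDensity r (Φ.flow s z) x) * Yt (σ ^ 3 * mollDensity r (Φ.flow s z) x)) * ∑ j, ∑ k, (a j k (s, x) - if j = k then (∑ i, a i i (s, x)) / 3 else 0) * (mollDensity r (Φ.flow s z) x * (∫ q, coneKernel r q.1 x * (q.2 j * q.2 k) ∂(empiricalMeasure (Φ.flow s z))) - mollMomentum r (Φ.flow s z) x j * mollMomentum r (Φ.flow s z) x k)) := hWP.1 s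
    have hCx : Integrable (fun x => 2 * (g (σ ^ 3 * mollDensity r (Φ.flow s z) x) * (hsPressure σ (mollDensity r (Φ.flow s z) x) (mollTemperature r (Φ.flow s z) x) - mollDensity r (Φ.flow s z) x * mollTemperature r (Φ.flow s z) x) * ∑ k, a k k (s, x))) := by
      refine (h2CW.sub (hWx.const_mul (8 * Real.pi / 15))).congr (ae_of_all _ fun x => ?_)
      simp only [Pi.sub_apply]
      ring
    rw [e1, integral_congr_ae (ae_of_all _ e2), integral_add hCx (hWx.const_mul _), integral_const_mul,
      integral_const_mul]
  -- Step C: the time level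
  rw [hA]
  simp_rw [hB]
  have hSI : IntegrableOn (fun s => ∑ k, ∑ l, σ ^ 3 * enskogRate σ N (a k l) g (evenMark k l) r s (Φ.flow s z))
      (Icc 0 t) :=
    integrable_finsetSum _ fun k _ => integrable_finsetSum _ fun l _ => (hIe k l).const_mul (σ ^ 3)
  have hSI' : IntegrableOn (fun s => 2 * (∫ x, g (σ ^ 3 * mollDensity r (Φ.flow s z) x) * (hsPressure σ (mollDensity r (Φ.flow s z) x) (mollTemperature r (Φ.flow s z) x) - mollDensity r (Φ.flow s z) x * mollTemperature r (Φ.flow s z) x) * ∑ k, a k k (s, x)) +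
      8 * Real.pi / 15 * ∫ x, σ ^ 3 * (g (σ ^ 3 * mollDensity r (Φ.flow s z) x) * Yt (σ ^ 3 * mollDensity r (Φ.flow s z) x)) * ∑ j, ∑ k, (a j k (s, x) - if j = k then (∑ i, a i i (s, x)) / 3 else 0) * (mollDensity r (Φ.flow s z) x * (∫ q, coneKernel r q.1 x * (q.2 j * q.2 k) ∂(empiricalMeasure (Φ.flow s z))) - mollMomentum r (Φ.flow s z) x j * mollMomentum r (Φ.flow s z) x k)) (Icc 0 t) :=
    hSI.congr (ae_of_all _ hB)
  have hWs : IntegrableOn (fun s => ∫ x, σ ^ 3 * (g (σ ^ 3 * mollDensity r (Φ.flow s z) x) * Yt (σ ^ 3 * mollDensity r (Φ.flow s z) x)) * ∑ j, ∑ k, (a j k (s, x) - if j = k then (∑ i, a i i (s, x)) / 3 else 0) * (mollDensity r (Φ.flow s z) x * (∫ q, coneKernel r q.1 x * (q.2 j * q.2 k) ∂(empiricalMeasure (Φ.flow s z))) - mollMomentum r (Φ.flow s z) x j * mollMomentum r (Φ.flow s z) x k)) (Icc 0 t) := hWP.2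
  have hCs : IntegrableOn (fun s => 2 * ∫ x, g (σ ^ 3 * mollDensity r (Φ.flow s z) x) * (hsPressure σ (mollDensity r (Φ.flow s z) x) (mollTemperature r (Φ.flow s z) x) - mollDensity r (Φ.flow s z) x * mollTemperature r (Φ.flow s z) x) * ∑ k, a k k (s, x)) (Icc 0 t) := by
    refine (hSI'.sub (hWs.const_mul (8 * Real.pi / 15))).congr (ae_of_all _ fun s => ?_)
    simp only [Pi.sub_apply]
    ring
  rw [integral_add hCs (hWs.const_mul _), integral_const_mul, integral_const_mul]

/-! ## Registered sub-goal -/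

/-- **REGISTERED SUB-GOAL `stub_pressureValuePathwise`** of `stub_pressureValueOfEvenStress`: the deterministic identity
`sum_enskog_integral_eq` along a good orbit. [folklore] -/
theorem stub_pressureValuePathwise : ∀ {N : ℕ} {σ r t η₀' η₁ : ℝ} {Yt g : ℝ → ℝ} {a : Fin 3 → Fin 3 → ℝ × T3 → ℝ}, (∀ b ∈ Set.Ioo 0 η₁, Yt b = contactValue b) → (∀ b, η₀' ≤ b → g b = 0) → η₀' ≤ η₁ → 0 < η₀' → 0 < σ → 0 < r → (∀ j k, Continuous (a j k)) → Continuous g → Continuous Yt → ∀ (Φ : HardSphereFlow (Torus.geometry (Fin 3)) (hsDiameter σ N) (N + 1)) {z : Config (N + 1) (Fin 3) T3}, z ∈ Φ.good → (∑ k, ∑ l, σ ^ 3 * ∫ s in Set.Icc 0 t, enskogRate σ N (a k l) g (evenMark k l) r s (Φ.flow s z)) = 2 * (∫ s in Set.Icc 0 t, ∫ x, g (σ ^ 3 * mollDensity r (Φ.flow s z) x) * (hsPressure σ (mollDensity r (Φ.flow s z) x) (mollTemperature r (Φ.flow s z) x) - mollDensity r (Φ.flow s z) x * mollTemperature r (Φ.flow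 s z) x) * ∑ k, a k k (s, x)) + 8 * Real.pi / 15 * ∫ s in Set.Icc 0 t, ∫ x, max (σ ^ 3 * mollDensity r (Φ.flow s z) x) 0 * g (σ ^ 3 * mollDensity r (Φ.flow s z) x) * Yt (σ ^ 3 * mollDensity r (Φ.flow s z) x) * ∑ j, ∑ k, (a j k (s, x) - if j = k then (∑ i, a i i (s, x)) / 3 else 0) * ((∫ q, coneKernel r q.1 x * (q.2 j * q.2 k) ∂(empiricalMeasure (Φ.flow s z))) - mollMomentum r (Φ.flow s z) x j * mollMomentum r (Φ.flow s z) x k / mollDensity r (Φ.flow s z) x) :=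
  fun hY hg0 hle hη hσ hr ha hg hYt Φ _ hz => sum_enskog_integral_eq hY hg0 hle hη hσ hr ha hg hYt Φ hz

end Summit.AtomisticToContinuum.HydrodynamicLimit.Theorems.ParityBandClosurePressureValue

end
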